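import Summits.CriticalPhenomena.PercolationContinuityZ3.Theorems.PercNearOneGluingNoHeavyLowerTailSunflowerBipartiteCorollaries
import Mathlib.Combinatorics.SimpleGraph.Coloring.Constructions
import Mathlib.Combinatorics.SimpleGraph.CycleGraph
import HarnessLib

/-!
# `NoHeavyLowerTail` (crux stmt-CriticalPhenomena-4575), abstract sunflower cubic: the LEAF-LEAF EDGE CONJECTURE and its consequence
# "EVERY CYCLE HAS AN A-SAFE CORE"

Support file (seat `prim-ineq-prove-1` gen 49; `--supports stmt-CriticalPhenomena-4575`).  No `sorry`; one definition is a named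
CONJECTURE (`LeafLeafSafe`, marked `@[conjecture]`) used only as a hypothesis.  Memo:
run/shared/lean/prim/prim-ineq-prove-1/FINDING-PENDANT-prove1-g49.md §6g–§6h.

SETTING (`…SunflowerSafeCalculus`, `…SunflowerGraphCoreTriangle`).  `Safe p A` = Lemma A in product form for the up-set `A` at the
product measure `p`; "A-safe" = safe at every `p`; `edgeCore Γ = {ω | some edge of Γ inside ω}`.  Conjecture G△ (`TriangleFreeSafe`):
every triangle-free graph has an A-safe core.  Known strata: bipartite graphs (`Bridge.safe_edgeCore_of_isBipartite`), Andrásfai graphs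
and their blow-ups, `C₅`, `C₇`, and closure under pendant vertices (`…SunflowerPendant.aSafe_edgeCore_add_pendant`) and disjoint edges.

THE LEAF-LEAF EDGE CONJECTURE (`LeafLeafSafe`).  If `z₁ ≠ z₂` are LEAVES of `Γ` hanging at distinct, non-adjacent anchors `u`, `w`
(`N(z₁) = {u}`, `N(z₂) = {w}`, `u ≠ w`, `u ≁ w`) and `edgeCore Γ` is A-safe, then the core of `Γ + z₁z₂` is A-safe.  It is the special
case "one of the two neighbours is a leaf" of the degree-2 attachment step, and — unlike that step — every proper face of its block
`(z₁, z₂, u, w)` is a pendant / disjoint-edge / one-coin core, all proved A-safe; the corresponding pure section relaxation (cells + all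
2-dimensional face systems, no independence input) has supremum `1.000000` in every test (`K ≤ 6`, kit j203346; unbounded `K` by LP +
integer search, kit j204089), whereas every aggregated 3–5-variable reduction of it is false (memo §6h).  So it is the lane's current
proof target; this file records what it buys:

* `safe_edgeCore_pathGraph` — paths have A-safe cores (bipartite stratum);
* `cycleGraph_eq_pathGraph_sup_edge` — `C_{n+3} = P_{n+3} + {0, n+2}`;
* **`safe_edgeCore_cycleGraph_of_leafLeafSafe`** — `LeafLeafSafe → ∀ n ≥ 5, ∀ p, Safe p (edgeCore (cycleGraph n))`: the two ends of the
  path `P_n` are leaves with anchors `1 ≠ n−2`, non-adjacent once `n ≥ 5`, so one leaf-leaf edge closes the cycle.  (`C₄` is bipartite,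
  `C₅`/`C₇` are in the tree unconditionally; `C_{2m+1}`, `m ≥ 5`, are otherwise open.)
More generally `LeafLeafSafe` + the pendant theorem give every graph built from an A-safe graph by attaching pendant trees and ears of
length `≥ 3`; ears of length `2` are the general degree-2 attachment (memo §6d–§6f), which needs the independence structure of the core.
-/

namespace Summit.CriticalPhenomena.PercolationContinuityZ3.Theorems.SunflowerPartition

namespace SafeCalc

open Finset

/-! ## The conjecture -/

/-- **The leaf-leaf edge conjecture.**  For a graph `Γ` on `Fin m` with leaves `z₁ ≠ z₂` whose unique neighbours `u ≠ w` are not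
adjacent: if `edgeCore Γ` is safe at every product measure then so is the core of `Γ ⊔ {z₁z₂}`.  Numerically verified as a pure
section relaxation (memo §6h); it implies that every cycle has an A-safe core (`safe_edgeCore_cycleGraph_of_leafLeafSafe`).
[conjecture, this work] -/
@[conjecture] def LeafLeafSafe : Prop :=
  ∀ (m : ℕ) (Γ : SimpleGraph (Fin m)) (z₁ z₂ u w : Fin m), z₁ ≠ z₂ → u ≠ w → ¬ Γ.Adj u w →
    (∀ x, Γ.Adj z₁ x ↔ x = u) → (∀ x, Γ.Adj z₂ x ↔ x = w) →
    (∀ p : Fin m → unitInterval, Safe p (edgeCore Γ)) →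
    ∀ p : Fin m → unitInterval, Safe p (edgeCore (Γ ⊔ SimpleGraph.fromEdgeSet {s(z₁, z₂)}))

/-! ## Paths and cycles -/

/-- Paths have A-safe cores (they are bipartite). [this work] -/
theorem safe_edgeCore_pathGraph (n : ℕ) (p : Fin n → unitInterval) : Safe p (edgeCore (SimpleGraph.pathGraph n)) := by
  refine Bridge.safe_edgeCore_of_isBipartite _ ?_ p
  have h := (SimpleGraph.pathGraph.bicoloring n).colorable
  simpa using h

/-- The value of a difference in `Fin (n+3)` equals `1` iff the two points are consecutive or wrap around the end. -/
theorem val_sub_eq_one_iff {n : ℕ} (u v : Fin (n + 3)) :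
    (u - v).val = 1 ↔ v.val + 1 = u.val ∨ (u.val = 0 ∧ v.val = n + 2) := by
  rcases le_or_gt v u with h | h
  · rw [Fin.coe_sub_iff_le.2 h]
    have hv := v.isLt; have hu := u.isLt
    constructor
    · intro h1; omega
    · intro h1; omega
  · rw [Fin.coe_sub_iff_lt.2 h]
    have hv := v.isLt; have hu := u.isLt
    constructor
    · intro h1; omega
    · intro h1; omega

/-- `C_{n+3}` is the path `P_{n+3}` plus the edge between its two ends. [this work] -/
theorem cycleGraph_eq_pathGraph_sup_edge (n : ℕ) :
    SimpleGraph.cycleGraph (n + 3) =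
      SimpleGraph.pathGraph (n + 3) ⊔ SimpleGraph.fromEdgeSet {s((0 : Fin (n + 3)), Fin.last (n + 2))} := by
  ext u v
  rw [SimpleGraph.sup_adj, SimpleGraph.fromEdgeSet_adj, SimpleGraph.cycleGraph_adj', SimpleGraph.pathGraph_adj,
    Set.mem_singleton_iff, Sym2.eq_iff, val_sub_eq_one_iff, val_sub_eq_one_iff]
  simp only [ne_eq, Fin.ext_iff, Fin.val_zero, Fin.val_last]
  have hu := u.isLt; have hv := v.isLt
  constructor
  · intro h; omega
  · intro h; omega

/-- In the path `P_{n+3}` the vertex `0` is a leaf with neighbour `1`. -/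
theorem pathGraph_adj_zero_iff {n : ℕ} (x : Fin (n + 3)) :
    (SimpleGraph.pathGraph (n + 3)).Adj 0 x ↔ x = (⟨1, by omega⟩ : Fin (n + 3)) := by
  rw [SimpleGraph.pathGraph_adj, Fin.ext_iff]
  simp only [Fin.val_zero]
  have hx := x.isLt
  constructor
  · intro h; omega
  · intro h; omega

/-- In the path `P_{n+3}` the last vertex is a leaf with neighbour `n+1`. -/
theorem pathGraph_adj_last_iff {n : ℕ} (x : Fin (n + 3)) :
    (SimpleGraph.pathGraph (n + 3)).Adj (Fin.last (n + 2)) x ↔ x = ⟨n + 1, by omega⟩ := by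
  rw [SimpleGraph.pathGraph_adj, Fin.ext_iff]
  simp only [Fin.val_last]
  have hx := x.isLt
  constructor
  · intro h; omega
  · intro h; omega

/-- **Every cycle `C_n`, `n ≥ 5`, has an A-safe core — conditionally on the leaf-leaf edge conjecture.**  (`C₅` and `C₇` are in
the tree unconditionally; `C₄` is bipartite.) [this work] -/
theorem safe_edgeCore_cycleGraph_of_leafLeafSafe (h : LeafLeafSafe) (n : ℕ) (hn : 5 ≤ n) (p : Fin n → unitInterval) :
    Safe p (edgeCore (SimpleGraph.cycleGraph n)) := by
  obtain ⟨k, rfl⟩ : ∃ k, n = k + 3 := ⟨n - 3, by omega⟩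
  rw [cycleGraph_eq_pathGraph_sup_edge k]
  refine h (k + 3) (SimpleGraph.pathGraph (k + 3)) 0 (Fin.last (k + 2)) ⟨1, by omega⟩ ⟨k + 1, by omega⟩ ?_ ?_ ?_
    (pathGraph_adj_zero_iff) (pathGraph_adj_last_iff) (safe_edgeCore_pathGraph (k + 3)) p
  · rw [ne_eq, Fin.ext_iff, Fin.val_zero, Fin.val_last]; omega
  · rw [ne_eq, Fin.ext_iff]; dsimp only; omega
  · rw [SimpleGraph.pathGraph_adj]
    dsimp only
    omega

end SafeCalc

end Summit.CriticalPhenomena.PercolationContinuityZ3.Theorems.SunflowerPartition
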